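import Literature.MathematicalPhysics.QuantumFieldTheory.QCDOS
import HarnessLib

/-!
# QuantumFields / QCD — sub-problem statement draft (D-0015 interface level; D-0017 layout)

Target path: `lean/Summits/QuantumFields/QCD/Statement.lean`. Ruling D-0018(2): conjunct kept as drafted
(`SU(3)`, `N_f` fundamental quarks; 2026-08-15 human rulings: `N_f = 2 ∧ N_f = 3`, all positive quark
masses, sequential continuum limit, lattice full-spectrum gap) apart from the gen-3 audit fixes (B1 asymptotic scaling; N1/N9 wording),
the gen-6 audit fixes (namespaces aligned to D-0022; `afBeta` normalised to the tree's `β = 2/g₀²`,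
the inverse bare coupling that `wilsonMeasure` actually takes — gen-6 B1) and the gen-8 audit fix
(B1: `reg.HasMassScaling`, without which `∀ m` was idle).
Imports the draft Literature interface files `QuantumFieldTheory/OSData.lean`,
`QuantumFieldTheory/YangMillsOS.lean`, `QuantumFieldTheory/QCDOS.lean` (must land first).

## Sources — there is NO official problem text for QCD (docs/m5/STATEMENT-SOURCES.md)

Jaffe–Witten, *Quantum Yang–Mills theory* (Clay 2000), §1 (verbatim): QCD is "a non-abelian gauge
theory in which the gauge group is `G = SU(3)`. The additional fields describe … 'quarks,' which
are spin 1/2 objects … transforming in the fundamental representation of `SU(3)`. … for QCD to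
describe the strong force successfully, it must have at the quantum level the following three
properties …: (1) It must have a 'mass gap;' namely there must be some constant `Δ > 0` such that
every excitation of the vacuum has energy at least `Δ`. (2) … 'quark confinement,' … (3) …
'chiral symmetry breaking,' which means that the vacuum is potentially invariant (in the limit,
that the quark-bare masses vanish) only under a certain subgroup of the full symmetry group";
§5 (verbatim): "one would like … to prove existence of other four-dimensional gauge theories
(incorporating additional fields that preserve asymptotic freedom), to understand dynamical
questions (such as the possible mass gap, confinement, and chiral symmetry breaking) in these
more general theories". Lattice framework: Osterwalder–Seiler 1978; Seiler 1982, Ch. 3.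

## Rendering and the parameter choices (what field experts would accept, and why)

* "exists in the same axiomatic sense": `∃ T : OSData (QCDField N_f) 4` — joint Schwinger
  functions of the gauge-invariant hermitian composite fields `tr F²`, `Re/Im ψ̄_f iγ₅ ψ_g`
  with E0, E0', E1–E4 as fields (fermions enter only through gauge-invariant bosonic composites,
  so the scalar OS axioms are the right ones; no spinor OS axioms are needed). Caveat (audit g3
  N1): the lattice representative of `glue` is the Wilson action density renormalised only
  multiplicatively/additively; with Wilson fermions (chiral symmetry broken) it mixes with the
  lower-dimensional singlet scalar density `a⁻¹ ψ̄ψ`, so the continuum field labelled `glue` is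
  "the leading flavour-singlet scalar the plaquette excites" — expected `∑_f ψ̄_f ψ_f`, not
  `tr F²`, unless the scheme is given a subtraction (open question for the human).
* "is QCD": `IsQCDFor N_f T` — the joint Schwinger functions are, on `⁰𝒮`, continuum limits of
  honest lattice QCD expectations (Wilson gauge action, `N_f` Wilson–Dirac fermions integrated
  by the Berezin integral, signed determinant) along a scheme whose bare coupling obeys two-loop
  ASYMPTOTIC SCALING (`QCDScheme.HasAsymptoticScaling`, stated for the tree's `β = 2/g₀²`; audits g3
  B1 / g6 B1 — this is what makes `a` the lattice spacing of the asymptotically free theory: too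
  slow a growth of `β(a)` admits free-pion scaling limits along the Wilson chiral critical line,
  too fast a growth forces a massless deep-UV limit) and whose bare masses stay on the physical
  branch `m_f(a) > −1` (doublers at the cutoff). Interface predicate / definitional placeholder.
* "non-trivial", and quarks DYNAMICAL (not decoupled): `T.IsNontrivial glue ∧ T.IsNonGaussian glue
  ∧ ∀ f ≠ g, T.IsNontrivial (pseudoRe f g)` — the gluonic field is neither a c-number nor a
  generalised free field, and every flavour propagates: the FLAVOUR-CHANGING pseudoscalar
  `Re ψ̄_f iγ₅ ψ_g` has a purely connected two-point function, which dies at every physical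
  separation for infinitely heavy quarks and vanishes for `z ≡ 0`; without this clause `QCD`
  would reduce to `YangMills`. (Flavour-diagonal `ψ̄_f iγ₅ ψ_f` would NOT do: its hairpin
  contraction has a gluonic heavy-quark limit `∝ FF̃`, rescuable by `z(a)`.)
* "mass gap … every excitation of the vacuum has energy at least `Δ`": ONE rate `Δ > 0` for the
  whole family, `T.HasMassGap Δ` (⟺ `σ(H) ∩ (0, Δ) = ∅` on the full reconstructed Hilbert space
  `ℋ_T`), AND — expert standard "mass gap = full spectrum", ruling D-0018(2) item 2, applied to
  QCD as to `YangMills` (audits g4 Q2, g6 Q4; 2026-08-15) — the lattice-level clause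
  `sch.HasLatticeMassGap Δ` for the SAME scheme: connected Euclidean-time correlations of ALL
  pairs of gauge-invariant local lattice QCD observables (bounded link functions × quark
  polynomials: Wilson loops, mesons, baryons, …) decay at rate `Δ` in physical units on every
  torus at least the scheme's, uniformly in the volume (Jaffe–Witten §5 "uniform gap for
  finite-volume approximations"; form F5). Without it the gap would be certified only on the
  cyclic space of `{glue, ψ̄iγ₅ψ}` (baryon number `0`), which a witness could shrink.
* **`N_f = 2` AND `N_f = 3` (conjunction)** — human ruling 2026-08-15, Q2 (superseding the earlier
  `∃ N_f ∈ [2, 16]`): the two physically relevant flavour numbers must both be constructed. At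
  least two flavours are also what lets flavour-changing bilinears certify dynamical quarks
  (`QCDOf 1` is well-formed but not protected against decoupling). REMARK, not a conjunct: the
  construction is expected to extend to every `N_f` below the conformal window; Jaffe–Witten's
  §5 restriction "fields that preserve asymptotic freedom" is `N_f ≤ 16` for fundamental Dirac
  flavours (`IsQCDAlong` keeps the Wilson doublers heavy so that `N_f` counts flavours), and
  `QCDOf N_f` remains the parametric statement for those extensions.
* **Quark masses — ALL positive renormalised masses (`∀ m_f > 0`)** — human ruling 2026-08-15,
  Q2 (superseding `∃` masses): quark masses are free parameters of QCD, and the theory must exist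
  for every value. Renormalised masses are made precise WITHOUT a renormalisation condition on
  the constructed theory (any hadronic prescription would make some tuples unrealisable — QCD
  mass inequalities): the statement asks for ONE mass-independent lattice regularisation
  `reg : QCDRegularisation N_f` (spacings, bare couplings, volumes, the flavour-blind critical bare
  Wilson mass `m_crit(k)` and `Z_m(k) > 0`, Montvay–Münster §5.1) whose `Z_m` has the universal
  leading-log growth `Z_m(k) ≍ c (log a_k⁻²)^{γ₀/(2β₀)}` of the renormalisation-group-invariant
  quark mass (`reg.HasMassScaling`; Montvay–Münster (5.84), (5.91)) such that for EVERY
  `m : Fin N_f → ℝ` with `m_f > 0` the bare trajectory `m_f(k) = m_crit(k) + a_k m_f / Z_m(k)`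
  yields massive QCD with all the properties below. Audit g8 B1: the mass-scaling clause is what
  makes `∀ m` bite — with `Z_m` free, a runaway `Z_m(k)` drives every tuple onto the single
  trajectory `m_crit(k)` and `∀ m` collapses to "one flavour-degenerate massive QCD"; with it the
  realised RGI masses are `M_f = M₀ + κ m_f` (`κ > 0` fixed by the unit choice `c`), an honest
  `N_f`-parameter family with every mass splitting. READING (audit g7, formal:
  `qcdOf_iff_threshold` — `QCDOf N_f ↔ ∃ M₀ ≥ 0, ∃ reg, … ∀ m, (∀ f, M₀ < m_f) → …`): the
  flavour-blind offset `M₀ ≥ 0` hidden in `m_crit` is not pinned by any bare datum (the additive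
  mass renormalisation is known only to `O(aΛ)`; shifting `m_crit(k)` by `a_k M₀/Z_m(k)` maps
  witnesses to witnesses), so "∀ m > 0" asserts massive QCD for ALL MASS SPLITTINGS and all masses
  above a witness-dependent common offset — NOT the chiral regime `m → 0⁺`. Reaching it can only
  be demanded through physics (a clause `∀ ε > 0, ∃ m > 0, ¬ (reg.scheme m 0 0).HasLatticeMassGap ε`:
  "arbitrarily small lattice gaps occur at positive masses"), which imports the gaplessness of massless `N_f ≥ 2` QCD and is
  NOT part of this conjunct pending a human ruling (audit g7 Q1). A per-tuple `∃` of bare masses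
  would likewise be fitted away. Non-decoupling and the gap remain conclusions for every `m`.
* NOT part of the conjunct (D-0015 (3), vendored out): confinement, chiral symmetry breaking.
-/

open Literature.MathematicalPhysics.QuantumFieldTheory

/-- **QCD with `N_f` flavours exists, for every tuple of positive renormalised quark masses of one
mass-independent regularisation (all mass splittings; the common additive offset pinned to the
chiral point — statement re-type 2026-08-16, formerly audit g7's open question), and has a mass
gap** (parametric form; human rulings 2026-08-15 Y2/Q1/Q2; audit g8 B1): there is ONE mass-independent
lattice regularisation `reg` (spacings `a_k → 0`, bare couplings `β_k` with two-loop asymptotic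
scaling, volumes `a_k L_k → ∞`, flavour-blind critical bare mass `m_crit(k)`, mass renormalisation
`Z_m(k) > 0` with the universal leading-log growth `(log a_k⁻²)^{γ₀/(2β₀)}` — `reg.HasMassScaling` —
and CHIRAL AT ZERO, `reg.IsChiralAtZero`: for every `ε > 0` some positive mass tuple has NO uniform
lattice gap `ε`, i.e. the lattice gap closes as `m → 0⁺`, which pins the additive offset `M₀` of
`m_crit` to `0` — without it `∀ m > 0 ≡ ∀ m > M₀`, `qcdOf_iff_threshold`, semantic-vacuity audit
§2.5-B) such that for EVERY tuple of renormalised quark masses `m_f > 0`, along the bare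
trajectory `m_f(k) = m_crit(k) + a_k m_f / Z_m(k)` (with some species renormalisations
`z_s(k), shift_s(k)`), there are OS data `T` for the species `QCDField N_f` (`glue` — the leading flavour-singlet scalar the Wilson action
density excites: under Wilson fermions the plaquette mixes with `a⁻¹ ψ̄ψ` and lower-dimensional
singlet operators, so `IsNontrivial glue`/`IsNonGaussian glue` certify an interacting flavour-singlet
scalar channel, `tr F²` only up to this mixing (semantic-vacuity audit §2.5-D, documented, no
subtraction imposed) — and the hermitian pseudoscalar bilinears) which are
`SU(3)` gauge theory with `N_f` fundamental Wilson–Dirac quarks in the sense of `IsQCDFor`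
(asymptotically free continuum limit of lattice QCD), with
non-trivial, non-Gaussian gluonic field, dynamical (non-decoupled) quarks — every flavour-changing
pseudoscalar `Re ψ̄_f iγ₅ ψ_g`, `f ≠ g`, is not a c-number — and one mass gap `Δ > 0` of the FULL
Hamiltonian: `T.HasMassGap Δ` (all species strings, the whole reconstructed space `ℋ_T`) and, at
the same couplings and bare masses, `sch.HasLatticeMassGap Δ` (ALL gauge-invariant local lattice
QCD observables — Wilson loops, mesons, baryons — uniformly in the spacing and the volume, so the
lattice Hamiltonians have no spectrum in `(0, Δ)` on the full physical Hilbert space, exactly as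
for `YangMills`); the continuum limit is taken along the SEQUENCE `k → ∞`. (`QCDOf 0`, `QCDOf 1`
have a vacuous quark clause.) [problem: constructive-qft]
[cite: JaffeWitten2000, §1 and §5] [cite: MontvayMunster1994, §5.1 (5.84)] -/
def QCDOf (Nf : ℕ) : Prop :=
  ∃ reg : QCDRegularisation Nf, reg.HasMassScaling ∧ reg.IsChiralAtZero ∧ ∀ m : Fin Nf → ℝ, (∀ f, 0 < m f) →
    ∃ (z shift : QCDField Nf → ℕ → ℝ) (T : OSData (QCDField Nf) 4),
      IsQCDAlong (reg.scheme m z shift) T ∧ T.IsNontrivial QCDField.glue ∧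
        T.IsNonGaussian QCDField.glue ∧
          (∀ f g : Fin Nf, f ≠ g → T.IsNontrivial (QCDField.pseudoRe f g)) ∧
            ∃ Δ > 0, T.HasMassGap Δ ∧ (reg.scheme m z shift).HasLatticeMassGap Δ

/-- **QCD** (conjunct of the summit `QuantumFields`; no official problem text — Jaffe–Witten
2000 §1 property (1) and §5 "existence of other four-dimensional gauge theories (incorporating
additional fields that preserve asymptotic freedom) … mass gap"; human ruling 2026-08-15, Q2:
"the statement must hold for `N_f = 2` AND `N_f = 3`, for ALL positive quark masses"): for the two
physically relevant flavour numbers `N_f = 2` and `N_f = 3`, and for EVERY tuple of positive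
renormalised quark masses of one mass-independent regularisation (all splittings; the common
additive offset pinned to the chiral point by `IsChiralAtZero` — the lattice gap closes as
`m → 0⁺`; re-type 2026-08-16), `SU(3)` Yang–Mills theory minimally coupled to `N_f` fundamental Dirac
quarks exists as Osterwalder–Schrader data tied to lattice QCD (continuum limit along a sequence
of spacings), with dynamical quarks and a mass gap of the full Hamiltonian (continuum species and
all lattice observables) — `QCDOf 2 ∧ QCDOf 3`. REMARK (not a conjunct): the construction is
expected to extend to every `N_f` below the conformal window (`QCDOf N_f`; asymptotic freedom
holds for `N_f ≤ 16`, `IsQCDAlong` keeps the doublers heavy). Open problem: a `Prop`, never asserted. [problem: constructive-qft] [cite: JaffeWitten2000, §1 and §5] [cite: Seiler1982, Ch. 3] -/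
def QCD : Prop :=
  QCDOf 2 ∧ QCDOf 3
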